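import Summits.PneNP.PneNP.Theses.OneSlice
import Literature.Computability.Complexity.Rossman2008
import Literature.Computability.Complexity.Rossman2008CliqueProofs
import Literature.Computability.Complexity.RossmanMonotoneClique
import Literature.Computability.Complexity.RossmanMonotoneCliqueProofs
import Literature.Computability.Complexity.ACFourierTails
import Literature.Computability.Complexity.CircuitInputMap

/-!
# Line `binomial-hybrid-influence-budget` for crux `SliceACZero` (stmt-PneNP-2835) — skeleton v2

Route `OneSlice` (sub-problem `PneNP`); crux decl `Summit.PneNP.PneNP.Theses.OneSlice.SliceACZero`
= `Hyp → Conc` (read back in `Theorems/SliceACZero/Negative/LoadBearing.lean`, `sliceACZero_iff`,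
`Iff.rfl`): `Hyp` = fixed-`δ`, window-uniform, single-threshold average-case AC⁰ lower bound for
`k`-CLIQUE on `G(n,q)`; `Conc` = the same on every central Hamming slice `G(n,j)`,
`|j − m_k(n)| ≤ m_k(n)^{3/4}`, `m_k(n) = ⌊C(n,2)·n^{−2/(k−1)}⌋`.

IDEA (card `Cruxes/SliceACZero/Ideas/binomial-hybrid-influence-budget.md`; triage r1: pass × 3; one
lever shared with `filmus-mossel-hybrid` ≈ `russo-window-ladder`, so this is the merged "influence
line"). For a Boolean test `f` on the `N = C(n,2)` edge indicators the Filmus–Mossel HYBRID over slices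
bounds the slice-vs-binomial gap by a biased INFLUENCE BUDGET,
`|E_{ν_m} f − E_{μ_{m/N}} f| ≤ K · (√m / N) · I_{m/N}(f)` for EVERY `f` (theorem `hybrid`, PROVED here
from two registered stubs — the one-edge slice coupling `stub_sliceCoupling` = FM L8.1 and the
log-concavity estimate for the binomial `stub_binomialRatio` = FM L8.3 — together with the
Russo–Margulis identity on slices `russoSlice` = FM L8.2, which is PROVED here), where
`I_q(f) = Σ_e Pr_{μ_q}[f(x) ≠ f(x ⊕ e)]`. The budget of
an AC⁰ test is small: `q · I_q(C) ≤ K_d (log s)^{d−1}` for all `0 < q ≤ 1/2` (`acInfluence`, PROVED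
from the exact AND-coin identity `stub_andCoin`, `Circuit.exists_restrict`, and Boppana's uniform bound
`boppana`, itself PROVED here by the transport `E(K_n) ≃ Fin N` from two registered stubs: the cube
identity `I[g] = Σ_{k≥1} W^{≥k}[g]` (`stub_influenceFourier`, the one standard lemma missing next to
`BooleanFourier.lean`) and the Tal-tail summation `Σ_{k≥1} W^{≥k}[C] ≤ K_d (log s)^{d−1}`
(`stub_boppanaTail`, from `Circuit.exists_acForm` + `ACForm.tailWeight_le_tailBound` in tree)); so is
the budget of the target: `q · I_q(CLIQUE_k) ≤ C(k,2)` (`cliqueInfluence`, PROVED here: `q · I_q(f)` is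
the expected number of present pivotal edges, `mul_influence_eq_expect_presentPivotal`, and a present
pivotal edge of `CLIQUE_k` lies in every `k`-clique, `cliquePivotal`). XOR-subadditivity (`infl_le_of_bne`, proved) then gives the unconditional
SLICE GAP `|sliceErr_j/sliceCard_j − gnpErr_{j/N}| ≤ (K₁ (log(n+2))^{d−1} + K₂)/√j` for `1 ≤ j ≤ N/2`,
`|C| ≤ n^c` (`sliceGap`, proved); the window asymptotics (`window_rate`, proved: for `k ≥ 3`, eventually
every central `j` has `1 ≤ j ≤ N/2`, `n ≤ 8j`, rate `≤ ε`) feed the common reduction `SliceACZero_of`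
(proved, concludes the crux BY NAME): `Hyp(d,c)` gives `(k, δ)`; answer `Conc(d,c)` with `(k, δ/2)`; a
`δ/2`-slice-accurate `C` with `|C| ≤ n^c` is `δ`-accurate on `G(n, j/N)` by SLICE GAP, and `q = j/N`
is in `Hyp`'s window (`qN = j`), so `Hyp` (used ONCE, at the matched density, same `(d,c)`) gives
`n^c < |C|`.

COMPOSITION (kernel-checked; `sorry` only inside the FIVE stubs S1–S5):
`stub_sliceCoupling` + `russoSlice` (proved) + `stub_binomialRatio` ⟶ `hybrid` (proved: termwise
`tail_s · π_s ≤ K(√m/N) · B_s q^s(1−q)^{N−1−s}`, cancelling `C(N,s)(N−s) > 0`);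
`stub_influenceFourier` + `stub_boppanaTail` ⟶ `boppana` (proved: `Circuit.mapInputs (equivFin)`,
`gnpDisagreeProb n ½ f g = #{f ≠ g}/2^N`, `Finset.card_equiv`); `stub_andCoin` + `boppana` ⟶
`acInfluence` (proved: restrict by `y`, `Circuit.exists_restrict`); `russoSlice`-style pairing ⟶
`mul_influence_eq_expect_presentPivotal` + `cliquePivotal` ⟶ `cliqueInfluence` (proved); `hybrid` +
`acInfluence` + `cliqueInfluence` ⟶ `sliceGap` (proved); `window_bounds` + `rate_small` ⟶ `window_rate` (proved);
`sliceGap` + `window_rate` + `Hyp` at `q = j/N` ⟶ `SliceACZero` (`SliceACZero_of`, proved). The derived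
theorems `hybrid`, `boppana` and `cliqueInfluence` have EXACTLY the statements of the v1 skeleton's
`stub_hybrid` / `stub_boppana` / `stub_cliqueInfluence` (gen-1, 2026-08-16T02:23Z), so a direct proof of a
v1 stub still plugs in unchanged.

DISPROOF USED (`Cruxes/SliceACZero/Disproof.lean` v4, NO KILL; landed and importable, imported in the
scratch check: `Theorems/SliceACZero/Negative/LoadBearing.lean`, `LoadBearingHyp.lean`):
`Negative.not_innerConcNoWindow` / `not_innerConcWindowAbove` — the window is consumed twice, in
`window_rate` (`j ≥ m_k − m_k^{3/4} ≥ m_k/2 ≥ 1` makes the rate `polylog/√j` small, `j ≤ 2m_k ≤ N/2`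
makes `q = j/N ≤ 1/2`) and in `SliceACZero_of` (`|qN − m_k| ≤ m_k^{3/4}` is `Hyp`'s window clause);
`Negative.not_innerConcNoBasis` / `not_innerHypNoBasis` — the basis enters twice: `Hyp` is applied to the
SAME circuit `C` (over `acBasis`), and `stub_boppanaTail` needs `acBasis` (parity: `I = N`);
`Negative.not_innerConcNoError` — the accuracy hypothesis is the input of the reduction (`herr`);
Disproof Part II `lt_of_innerHyp` / `not_concForallK` and Part IV `not_concDeltaFirst` — `(k, δ)` are
TAKEN from `Hyp d c` (`c < k`, `δ < 1/k!` inherited), `Conc` answered with `(k, δ/2)`; Part V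
`not_innerConcLowWindow` — only `j ≥ m_k/2` is used. No stub speaks about the crux's clauses at all (they
are statements about binomial laws, influences and Fourier tails of ARBITRARY tests / AC⁰ circuits /
CLIQUE), so none is an instance of a landed Negative lemma. A future `SliceACZero_false_without_Hyp` is
honoured in `SliceACZero_of`; the vendored `rossman2008_thm11` (refuted as printed) is never touched.
Negatives index (`ledger negatives --problem PneNP`) — none concerns slices / AC⁰ / random graphs.
-/

set_option linter.dupNamespace false

noncomputable section

namespace Summit.PneNP.PneNP.Cruxes.SliceACZero.BinomialHybridInfluenceBudget

open Finset Filter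
open Literature.Computability.Complexity
open Summit.PneNP.PneNP.Theses.OneSlice (SliceACZero)

/-! ## Stubs (registered obligations of the line)

Vocabulary used verbatim in the stub statements (tree declarations only, no line-local `def`):
* edge vectors `x : (⊤ : SimpleGraph (Fin n)).edgeSet → Bool`, `N = C(n,2)`, `edgeCount x = #{e | x e}`,
  `gnpWeight n q x = q^{e(x)} (1-q)^{N-e(x)}`, `gnpProb n q S = Σ_{x ∈ S} gnpWeight n q x`,
  `gnpDisagreeProb n q f g = Σ_{x : f x ≠ g x} gnpWeight n q x` (`Rossman2008.lean`,
  `RossmanMonotoneClique.lean` — the route's own finite-sum vocabulary), `cliqueFn n k` (k-CLIQUE);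
* the **`q`-biased total influence** of `f`: `I_q(f) = Σ_e gnpDisagreeProb n q f (fun x => f (Function.update x e (!x e)))`
  (`= Σ_e Pr_{μ_q}[f(x) ≠ f(x ⊕ e)]`);
* the **slice average** of `[f = 1]` on `G(n,m)`: `#{x | e(x) = m ∧ f x} / #{x | e(x) = m}`;
* the **boundary count** between levels `s` and `s+1`:
  `B_s(f) = #{(x,e) | e(x) = s ∧ x e = false ∧ f x ≠ f (Function.update x e true)}` (pairs in
  `(E → Bool) × E`); `π_s = B_s / (C(N,s)·(N−s))` is the flip rate of the one-edge coupling `ν_s → ν_{s+1}`;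
* binomial laws as explicit sums: `P[Bin(N,q) ≤ s] = Σ_{i ∈ range (s+1)} C(N,i) q^i (1−q)^{N−i}`,
  `P[Bin(N,q) ≥ s+1] = Σ_{i ∈ Ioc s N} C(N,i) q^i (1−q)^{N−i}`, and
  `N · P[Bin(N−1,q) = s] = C(N,s)·(N−s)·q^s (1−q)^{N−1−s}`;
* uniform-cube Fourier tails `LowDegree.tailWeight g k = W^{≥k}[g] = Σ_{|S| ≥ k} ĝ(S)²` over
  `cubeFourierCoeff` (`BooleanFourier.lean`, `FourierTails.lean`) and `sgn : Bool → ℝ` (`LowDegree.lean`). -/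

/-- **Stub S1 — one-edge slice coupling / hybrid inequality (Filmus–Mossel 2019 §8, Lemma 8.1; size M/L).**
For every Boolean `f` on the edge vectors of `K_n`, every `0 ≤ q ≤ 1` and every `m ≤ N = C(n,2)`:
`|E_{ν_m} f − E_{μ_q} f| ≤ Σ_{s<m} P[Bin(N,q) ≤ s]·π_s + Σ_{m ≤ s < N} P[Bin(N,q) ≥ s+1]·π_s` with
`π_s = B_s(f)/(C(N,s)(N−s))`. Proof: `μ_q = Σ_t b_t ν_t`, `b_t = P[Bin(N,q) = t]` (`Σ_t b_t = 1`;
`gnpWeight` is constant `q^t(1−q)^{N−t}` on slice `t`, and `#slice_t = C(N,t)` as in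
`Negative.sliceCard_eq`), so `E_{ν_m} f − E_{μ_q} f = Σ_t b_t (E_{ν_m} f − E_{ν_t} f)`; the coupling
"`X ~ ν_s`, switch on a uniformly random absent edge" has law `ν_{s+1}` exactly (every `y` of weight
`s+1` arises from `s+1` pairs `(x,e)`, each of mass `1/(C(N,s)(N−s))`), hence
`|E_{ν_{s+1}} f − E_{ν_s} f| ≤ P[f(X) ≠ f(X+e)] = π_s`, `|E_{ν_m} f − E_{ν_t} f| ≤ Σ_{min(m,t) ≤ s < max(m,t)} π_s`,
and regrouping charges level `s < m` with `Σ_{t ≤ s} b_t`, level `s ≥ m` with `Σ_{t ≥ s+1} b_t`. Pure double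
counting, no analysis; tight for `q ∈ {0,1}` (brute force, exact rationals: worst lhs/rhs = 1.000, all
`N ≤ 7`, 3768 cases, `checks/stub_checks_v2.py`). Why it might fail: it does not; cost = the
`(x,e) ↦ x+e` double count (`(s+1)`-to-`1`) and `Finset.sum_comm`/telescoping bookkeeping.
[cite: FilmusMossel2019 §8 Lemma 8.1; arXiv:1512.06009] -/
theorem stub_sliceCoupling (n m : ℕ) (q : ℝ) (hq0 : 0 ≤ q) (hq1 : q ≤ 1) (hm : m ≤ n.choose 2)
    (f : ((⊤ : SimpleGraph (Fin n)).edgeSet → Bool) → Bool) :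
    |(#(univ.filter fun x : (⊤ : SimpleGraph (Fin n)).edgeSet → Bool =>
          edgeCount x = m ∧ f x = true) : ℝ) /
        #(univ.filter fun x : (⊤ : SimpleGraph (Fin n)).edgeSet → Bool => edgeCount x = m)
      - gnpProb n q (univ.filter fun x => f x = true)|
    ≤ ∑ s ∈ range (n.choose 2),
        (if s < m then
            ∑ i ∈ range (s + 1), ((n.choose 2).choose i : ℝ) * q ^ i * (1 - q) ^ (n.choose 2 - i)
          else
            ∑ i ∈ Ioc s (n.choose 2), ((n.choose 2).choose i : ℝ) * q ^ i * (1 - q) ^ (n.choose 2 - i)) *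
        ((#(univ.filter fun p : ((⊤ : SimpleGraph (Fin n)).edgeSet → Bool) ×
              (⊤ : SimpleGraph (Fin n)).edgeSet =>
            edgeCount p.1 = s ∧ p.1 p.2 = false ∧ f p.1 ≠ f (Function.update p.1 p.2 true)) : ℝ) /
          (((n.choose 2).choose s : ℝ) * ((n.choose 2 - s : ℕ) : ℝ))) := by
  sorry

/-- **Stub S2 — the binomial hybrid weights are `O(√m)` point masses (Filmus–Mossel 2019 §8, Lemma 8.3;
size M/L; the only analytic input of the lever).** There is an absolute `K` such that for all
`1 ≤ m ≤ N/2`, `q = m/N`, and every level `s < N`: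
`P[Bin(N,q) ≤ s] ≤ K √m · P[Bin(N−1,q) = s]` if `s < m`, and `P[Bin(N,q) ≥ s+1] ≤ K √m · P[Bin(N−1,q) = s]`
if `s ≥ m` (both written with `N·P[Bin(N−1,q)=s] = C(N,s)(N−s)q^s(1−q)^{N−1−s}` and the factor `√m/N`).
Proof: `Bin(N,q) = Y + ξ` with `Y ~ Bin(N−1,q)`, so `P[Bin(N,q) ≤ s] ≤ P[Y ≤ s]`, `P[Bin(N,q) ≥ s+1] ≤ P[Y ≥ s]`;
the pmf of `Y` is log-concave (`p_{s+1}/p_s = (N−1−s)q/((s+1)(1−q))` decreases), so `P[Y ≤ s]/p_s` is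
non-decreasing and `P[Y ≥ s]/p_s` non-increasing in `s`; `(N−1+1)q = m ∈ ℕ` makes `m−1` and `m` modes
(`p_{m−1} = p_m = p_max`), whence both ratios are `≤ 1/p_max`; finally `p_max ≥ 3/(20√m)`: Chebyshev with
`Var Y = (N−1)q(1−q) ≤ m` puts mass `≥ 3/4` on `|Y − EY| < 2√m`, an interval with `≤ 4√m + 1 ≤ 5√m` integers.
So `K = 7` works (numerics, job j010724: the sup of ratio/√m is `1.056` for `N ≤ 60` (exact rationals),
`1.186` over all `N ≤ 1500`, `1.236` at `N = 10^5`; it tends to `√(π/2)·√(1−q) ≤ 1.2533`). Why it might fail: it does not; cost = log-concavity/hazard-rate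
monotonicity as finite-sum induction + a variance identity for `Bin(N−1,q)` (or a direct Stirling-free
modal bound). [cite: FilmusMossel2019 §8 Lemma 8.3; arXiv:1512.06009] -/
theorem stub_binomialRatio :
    ∃ K : ℝ, 0 < K ∧ ∀ (N m s : ℕ), 1 ≤ m → 2 * m ≤ N → s < N →
      (s < m →
        ∑ i ∈ range (s + 1), (N.choose i : ℝ) * ((m : ℝ) / N) ^ i * (1 - (m : ℝ) / N) ^ (N - i)
          ≤ K * (Real.sqrt m / N) *
              ((N.choose s : ℝ) * ((N - s : ℕ) : ℝ) *
                (((m : ℝ) / N) ^ s * (1 - (m : ℝ) / N) ^ (N - 1 - s)))) ∧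
      (m ≤ s →
        ∑ i ∈ Ioc s N, (N.choose i : ℝ) * ((m : ℝ) / N) ^ i * (1 - (m : ℝ) / N) ^ (N - i)
          ≤ K * (Real.sqrt m / N) *
              ((N.choose s : ℝ) * ((N - s : ℕ) : ℝ) *
                (((m : ℝ) / N) ^ s * (1 - (m : ℝ) / N) ^ (N - 1 - s)))) := by
  sorry

/-- **Stub S3 — the AND-coin (random 0-restriction) identity (size M; exact, every Boolean `f`).**
For `0 ≤ q ≤ 1/2`, sampling `x = y ∧ z` with `y ~ μ_{2q}` and `z` uniform gives `x ~ μ_q`, and an edge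
`e` is pivotal for `z ↦ f(y ∧ z)` at `z` iff `y_e = 1` and `e` is pivotal for `f` at `x` (pivotality
depends on `x_{−e}` only, which is independent of `y_e`); summing over `e`:
`q · I_q(f) = ½ · Σ_y μ_{2q}(y) · I_{1/2}(z ↦ f(y ∧ z))`. Both sides are polynomials in `q`
(finite sums of `gnpWeight`s), so this is a finite re-summation over `(y,z) ↦ y ∧ z` with the
product-weight identity `Σ_{(y,z) ↦ x} w_{2q}(y) 2^{−N} = w_q(x)`. Why it might fail: it does not
(exact; brute-forced by three triagers and twice by planners, N ≤ 8); cost = product-measure bookkeeping.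
[cite: ODonnell2014 §8.4 (μ_p via random restriction); Boppana1997] -/
theorem stub_andCoin (n : ℕ) (q : ℝ) (hq0 : 0 ≤ q) (hq1 : q ≤ 1 / 2)
    (f : ((⊤ : SimpleGraph (Fin n)).edgeSet → Bool) → Bool) :
    q * ∑ e : (⊤ : SimpleGraph (Fin n)).edgeSet,
          gnpDisagreeProb n q f (fun x => f (Function.update x e (!x e)))
      = 1 / 2 * ∑ y : (⊤ : SimpleGraph (Fin n)).edgeSet → Bool, gnpWeight n (2 * q) y *
          ∑ e : (⊤ : SimpleGraph (Fin n)).edgeSet,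
            gnpDisagreeProb n (1 / 2) (fun z => f (fun i => y i && z i))
              (fun z => f (fun i => y i && Function.update z e (!z e) i)) := by
  sorry

/-- **Stub S4 — total influence is the sum of the Fourier tails (O'Donnell 2014, Prop. 2.21 + §2.3 /
Thm 2.38; size M; the one standard identity missing next to `BooleanFourier.lean`).** For every Boolean
`g` on `{0,1}^N` (uniform measure): `I[g] = Σ_i Pr_x[g(x) ≠ g(x ⊕ e_i)] = Σ_S |S| Ĝ(S)² = Σ_{k=1}^{N} W^{≥k}[G]`
for `G = sgn ∘ g ∈ {±1}`, in the `cubeFourierCoeff`/`tailWeight` normalisation (`Ĝ(S) = 2^{−N} Σ_x G(x)χ_S(x)`).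
Proof: `D_i G(x) = (G(x) − G(x ⊕ e_i))/2 ∈ {0, ±1}` has `E[(D_i G)²] = Pr[g(x) ≠ g(x ⊕ e_i)]` and Fourier
expansion `Σ_{S ∋ i} Ĝ(S) χ_S` (the `walsh` sign flip `χ_S(x ⊕ e_i) = −χ_S(x)` iff `i ∈ S`), so Parseval
(`sum_cubeFourierCoeff_sq`) gives `Inf_i = Σ_{S ∋ i} Ĝ(S)²`; sum over `i` and use `|S| = #{k ∈ [1,N] : k ≤ |S|}`.
Brute force (exact): all `g` for `N ≤ 3`, samples for `N = 4, 5` — 558/558. Why it might fail: it does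
not; cost = the derivative's expansion in the `walsh`/`cubeFourierCoeff` API (inversion + orthogonality
are in tree: `sum_cubeFourierCoeff_mul_walsh`, `sum_walsh_mul_walsh_index`, `sum_cubeFourierCoeff_sq`).
[cite: ODonnell2014 Prop. 2.21 and Thm 2.38; LinialMansourNisan1993] -/
theorem stub_influenceFourier (N : ℕ) (g : (Fin N → Bool) → Bool) :
    ∑ i : Fin N, (#(univ.filter fun x : Fin N → Bool => g x ≠ g (Function.update x i (!x i))) : ℝ) / 2 ^ N
      = ∑ k ∈ Icc 1 N,
          LowDegree.tailWeight (fun x => Literature.Probability.RandomGraphs.LowDegree.sgn (g x)) k := by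
  sorry

/-- **Stub S5 — Boppana's bound through Tal's tails, uniform measure, `Fin N` inputs (Boppana 1997;
Linial–Mansour–Nisan 1993; Tal 2017 Thm 3.6; size M).** For every `d ≥ 1` there is `K_d` such that every
circuit over `acBasis` (unbounded fan-in `∧/∨`, negations free and anywhere) of `acDepth ≤ d` with at
most `s ≥ 2` gates satisfies `Σ_{k=1}^{N} W^{≥k}[sgn ∘ C] ≤ K_d (log s)^{d−1}` (by Stub S4 this is the
uniform total influence `I(C)`). Route through the tree: `Circuit.exists_acForm` (a formula of height
`≤ d+1`, bottom fan-in `1`, effective size `≤ 2s`, same function); `ACForm.tailWeight_le_tailBound` with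
`M = 2s`, `d' = d+1 ≥ 2`, `t = 1 ≤ logM(2s)`, `ℓ = logM(2s) ≤ 5 log s` (`logM_two_mul_le`):
`W^{≥k} ≤ 8^{d+1}·exp(−k ln2/(B^{d+1} ℓ^{d−1}))`; the geometric series gives
`Σ_{k ≥ 1} W^{≥k} ≤ 8^{d+1}/(1 − e^{−a}) ≤ 8^{d+1}(1 + 1/a)`, `a = ln 2/(B^{d+1}ℓ^{d−1})`, i.e.
`≤ 8^{d+1}(1 + B^{d+1}(5 log s)^{d−1}/ln 2) ≤ K_d (log s)^{d−1}` using `log s ≥ log 2` (`d = 1`: a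
constant, `(log s)^0 = 1`; the pattern of the constant-chasing is `Circuit.l1Level_acBasis_le`). Why it
might fail: it does not (Tal's Thm 3.6 is PROVED in tree; LMN/Boppana classical); cost = the series and
constants. [cite: Boppana1997 Thm 1; LinialMansourNisan1993 Lemma 9; Tal2017 Thm 3.6] -/
theorem stub_boppanaTail (d : ℕ) (hd : 1 ≤ d) :
    ∃ K : ℝ, 0 < K ∧ ∀ (N s : ℕ) (C : Circuit (Fin N)),
      C.IsOver acBasis → C.acDepth ≤ d → C.size ≤ s → 2 ≤ s →
      ∑ k ∈ Icc 1 N,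
          LowDegree.tailWeight (fun x => Literature.Probability.RandomGraphs.LowDegree.sgn (C.eval x)) k
        ≤ K * Real.log s ^ (d - 1) := by
  sorry

/-! ## Proved glue I: Russo–Margulis on slices, and the hybrid inequality from Stubs S1–S2 (v1's `stub_hybrid`) -/

/-- Switching on an absent edge raises the edge count by one, and the count stays `≤ C(n,2)`.
[folklore] -/
theorem edgeCount_update_true {n : ℕ} (x : (⊤ : SimpleGraph (Fin n)).edgeSet → Bool)
    (e : (⊤ : SimpleGraph (Fin n)).edgeSet) (he : x e = false) :
    edgeCount (Function.update x e true) = edgeCount x + 1 ∧ edgeCount x + 1 ≤ n.choose 2 := by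
  classical
  have h1 : (univ.filter fun e' => Function.update x e true e' = true) =
      insert e (univ.filter fun e' => x e' = true) := by
    ext e'
    simp only [Finset.mem_filter, Finset.mem_univ, true_and, Finset.mem_insert]
    by_cases h : e' = e
    · subst h
      simp
    · rw [Function.update_of_ne h]
      simp [h]
  have hnot : e ∉ (univ.filter fun e' => x e' = true) := by simp [he]
  have hcard : edgeCount (Function.update x e true) = edgeCount x + 1 := by
    unfold edgeCount
    rw [h1, Finset.card_insert_of_notMem hnot]
  refine ⟨hcard, ?_⟩
  rw [← hcard]
  unfold edgeCount
  calc #(univ.filter fun e' => Function.update x e true e' = true)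
      ≤ #(univ : Finset ((⊤ : SimpleGraph (Fin n)).edgeSet)) := Finset.card_filter_le _ _
    _ = n.choose 2 := by rw [Finset.card_univ, card_edgeSet_top_fin]

/-- Per edge `e`: the `μ_q`-mass of the disagreement set `{x | f x ≠ f (x ⊕ e)}` equals the boundary
mass `Σ_{x : x_e = 0, f x ≠ f(x+e)} q^{e(x)} (1−q)^{N−1−e(x)}` — pair `x` with `x + e`, whose weights add up to
`q^s(1−q)^{N−s} + q^{s+1}(1−q)^{N−1−s} = q^s(1−q)^{N−1−s}`. Valid for every real `q`. [folklore] -/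
theorem disagree_eq_boundary {n : ℕ} (q : ℝ) (f : ((⊤ : SimpleGraph (Fin n)).edgeSet → Bool) → Bool)
    (e : (⊤ : SimpleGraph (Fin n)).edgeSet) :
    gnpDisagreeProb n q f (fun x => f (Function.update x e (!x e))) =
      ∑ x ∈ univ.filter (fun x : (⊤ : SimpleGraph (Fin n)).edgeSet → Bool =>
          x e = false ∧ f x ≠ f (Function.update x e true)),
        q ^ edgeCount x * (1 - q) ^ (n.choose 2 - 1 - edgeCount x) := by
  classical
  unfold gnpDisagreeProb
  set D := univ.filter (fun x : (⊤ : SimpleGraph (Fin n)).edgeSet → Bool =>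
    f x ≠ f (Function.update x e (!x e))) with hD
  set A := univ.filter (fun x : (⊤ : SimpleGraph (Fin n)).edgeSet → Bool =>
    x e = false ∧ f x ≠ f (Function.update x e true)) with hA
  rw [← Finset.sum_filter_add_sum_filter_not D (fun x => x e = false)]
  have hDA : D.filter (fun x => x e = false) = A := by
    ext x
    simp only [hD, hA, Finset.mem_filter, Finset.mem_univ, true_and]
    constructor
    · rintro ⟨h1, h2⟩
      rw [h2] at h1
      exact ⟨h2, by simpa using h1⟩
    · rintro ⟨h2, h1⟩
      refine ⟨?_, h2⟩
      rw [h2]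
      simpa using h1
  have hDB : ∑ x ∈ D.filter (fun x => ¬ x e = false), gnpWeight n q x =
      ∑ x ∈ A, gnpWeight n q (Function.update x e true) := by
    symm
    refine Finset.sum_nbij' (fun x => Function.update x e true) (fun x => Function.update x e false)
      ?_ ?_ ?_ ?_ ?_
    · intro x hx
      simp only [hA, hD, Finset.mem_filter, Finset.mem_univ, true_and] at hx ⊢
      obtain ⟨hxe, hne⟩ := hx
      have hback : Function.update (Function.update x e true) e
          (!Function.update x e true e) = x := by
        rw [Function.update_idem]
        simp only [Function.update_self, Bool.not_true]
        exact Function.update_eq_self_iff.2 hxe.symm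
      refine ⟨?_, by simp⟩
      rw [hback]
      exact fun h => hne h.symm
    · intro y hy
      simp only [hA, hD, Finset.mem_filter, Finset.mem_univ, true_and] at hy ⊢
      obtain ⟨hne, hye⟩ := hy
      have hye' : y e = true := by simpa using hye
      refine ⟨by simp, ?_⟩
      have hy1 : Function.update y e true = y := Function.update_eq_self_iff.2 hye'.symm
      rw [Function.update_idem, hy1]
      rw [hye'] at hne
      simp only [Bool.not_true] at hne
      exact fun h => hne h.symm
    · intro x hx
      simp only [hA, Finset.mem_filter, Finset.mem_univ, true_and] at hx
      have hx1 : Function.update x e false = x := Function.update_eq_self_iff.2 hx.1.symm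
      rw [Function.update_idem, hx1]
    · intro y hy
      simp only [hD, Finset.mem_filter, Finset.mem_univ, true_and] at hy
      have hye' : y e = true := by simpa using hy.2
      have hy1 : Function.update y e true = y := Function.update_eq_self_iff.2 hye'.symm
      rw [Function.update_idem, hy1]
    · intro x _
      rfl
  rw [hDA, hDB, ← Finset.sum_add_distrib]
  refine Finset.sum_congr rfl fun x hx => ?_
  have hxe : x e = false := ((Finset.mem_filter.1 hx).2).1
  obtain ⟨hc, hle⟩ := edgeCount_update_true x e hxe
  unfold gnpWeight
  rw [hc]
  have h1 : n.choose 2 - edgeCount x = (n.choose 2 - 1 - edgeCount x) + 1 := by omega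
  have h2 : n.choose 2 - (edgeCount x + 1) = n.choose 2 - 1 - edgeCount x := by omega
  rw [h1, h2, pow_succ, pow_succ]
  ring

/-- **Russo–Margulis on slices (Filmus–Mossel 2019 §8, Lemma 8.2; exact identity, PROVED — this was
a stub of this planner's first draft; = `RussoSliceIdentity` of card russo-window-ladder).** For every Boolean `f` and
EVERY real `q`: `I_q(f) = Σ_e Pr_{μ_q}[f(x) ≠ f(x ⊕ e)] = Σ_{s<N} B_s(f) · q^s (1−q)^{N−1−s}`
(`= N·Σ_s P[Bin(N−1,q)=s]·π_s`), `B_s(f) = #{(x,e) | e(x) = s, x_e = 0, f x ≠ f(x+e)}`. Proof: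
`disagree_eq_boundary` per edge, then the pairs `(x,e)` are regrouped by `e(x)`
(`Finset.sum_fiberwise_of_maps_to`). [cite: FilmusMossel2019 §8 Lemma 8.2; arXiv:1512.06009] -/
theorem russoSlice (n : ℕ) (q : ℝ) (f : ((⊤ : SimpleGraph (Fin n)).edgeSet → Bool) → Bool) :
    ∑ e : (⊤ : SimpleGraph (Fin n)).edgeSet,
        gnpDisagreeProb n q f (fun x => f (Function.update x e (!x e)))
      = ∑ s ∈ range (n.choose 2),
          (#(univ.filter fun p : ((⊤ : SimpleGraph (Fin n)).edgeSet → Bool) ×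
                (⊤ : SimpleGraph (Fin n)).edgeSet =>
              edgeCount p.1 = s ∧ p.1 p.2 = false ∧ f p.1 ≠ f (Function.update p.1 p.2 true)) : ℝ) *
            (q ^ s * (1 - q) ^ (n.choose 2 - 1 - s)) := by
  classical
  -- Step A: per edge
  rw [Finset.sum_congr rfl fun e _ => disagree_eq_boundary q f e]
  -- Step B: as a sum over boundary pairs `(x, e)`
  set P := univ.filter (fun p : ((⊤ : SimpleGraph (Fin n)).edgeSet → Bool) ×
      (⊤ : SimpleGraph (Fin n)).edgeSet => p.1 p.2 = false ∧ f p.1 ≠ f (Function.update p.1 p.2 true))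
    with hP
  have hpairs : ∑ e : (⊤ : SimpleGraph (Fin n)).edgeSet,
      ∑ x ∈ univ.filter (fun x : (⊤ : SimpleGraph (Fin n)).edgeSet → Bool =>
          x e = false ∧ f x ≠ f (Function.update x e true)),
        q ^ edgeCount x * (1 - q) ^ (n.choose 2 - 1 - edgeCount x)
      = ∑ p ∈ P, q ^ edgeCount p.1 * (1 - q) ^ (n.choose 2 - 1 - edgeCount p.1) := by
    simp only [hP, Finset.sum_filter]
    rw [Fintype.sum_prod_type]
    dsimp only
    rw [Finset.sum_comm]
  rw [hpairs]
  -- Step C: regroup by the weight of the vector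
  have hmaps : ∀ p ∈ P, edgeCount p.1 ∈ range (n.choose 2) := by
    intro p hp
    rw [hP, Finset.mem_filter] at hp
    rw [Finset.mem_range]
    have := (edgeCount_update_true p.1 p.2 hp.2.1).2
    omega
  rw [← Finset.sum_fiberwise_of_maps_to hmaps]
  refine Finset.sum_congr rfl fun s hs => ?_
  have hfilt : P.filter (fun p => edgeCount p.1 = s) =
      univ.filter (fun p : ((⊤ : SimpleGraph (Fin n)).edgeSet → Bool) ×
          (⊤ : SimpleGraph (Fin n)).edgeSet =>
        edgeCount p.1 = s ∧ p.1 p.2 = false ∧ f p.1 ≠ f (Function.update p.1 p.2 true)) := by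
    ext p
    simp only [hP, Finset.mem_filter, Finset.mem_univ, true_and]
    tauto
  rw [Finset.sum_congr rfl (g := fun _ => q ^ s * (1 - q) ^ (n.choose 2 - 1 - s))
    (fun p hp => by rw [(Finset.mem_filter.1 hp).2]), Finset.sum_const, nsmul_eq_mul, hfilt]

/-- Termwise bookkeeping of the hybrid bound: `T · (B/D) ≤ c · (B · w)` once `T ≤ c · (D · w)`,
`B ≥ 0`, `D > 0`. [folklore] -/
theorem term_bound {T B D w c : ℝ} (hB : 0 ≤ B) (hD : 0 < D) (hT : T ≤ c * (D * w)) :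
    T * (B / D) ≤ c * (B * w) := by
  have hD' : D ≠ 0 := hD.ne'
  calc T * (B / D) ≤ c * (D * w) * (B / D) := mul_le_mul_of_nonneg_right hT (div_nonneg hB hD.le)
    _ = c * (B * w) := by field_simp

/-- **Filmus–Mossel hybrid over slices, finite form (v1's `stub_hybrid`, now PROVED from S1, S2 and `russoSlice`).**
There is an absolute `K` such that for every Boolean `f` on the edge vectors of `K_n` and every
`1 ≤ m ≤ N/2` (`N = C(n,2)`): `|E_{ν_m} f − E_{μ_{m/N}} f| ≤ K · (√m / N) · I_{m/N}(f)`.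
[cite: FilmusMossel2019 §8 L8.1–8.3; arXiv:1512.06009] -/
theorem hybrid :
    ∃ K : ℝ, 0 < K ∧ ∀ (n m : ℕ) (f : ((⊤ : SimpleGraph (Fin n)).edgeSet → Bool) → Bool),
      1 ≤ m → 2 * m ≤ n.choose 2 →
      |(#(univ.filter fun x : (⊤ : SimpleGraph (Fin n)).edgeSet → Bool =>
            edgeCount x = m ∧ f x = true) : ℝ) /
          #(univ.filter fun x : (⊤ : SimpleGraph (Fin n)).edgeSet → Bool => edgeCount x = m)
        - gnpProb n ((m : ℝ) / (n.choose 2 : ℕ)) (univ.filter fun x => f x = true)|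
      ≤ K * (Real.sqrt m / (n.choose 2 : ℕ)) *
          ∑ e : (⊤ : SimpleGraph (Fin n)).edgeSet,
            gnpDisagreeProb n ((m : ℝ) / (n.choose 2 : ℕ)) f
              (fun x => f (Function.update x e (!x e))) := by
  classical
  obtain ⟨K, hK, hratio⟩ := stub_binomialRatio
  refine ⟨K, hK, ?_⟩
  intro n m f hm1 hmN
  have hNpos : 0 < n.choose 2 := by omega
  have hNr : (0 : ℝ) < ((n.choose 2 : ℕ) : ℝ) := by exact_mod_cast hNpos
  have hmN' : m ≤ n.choose 2 := by omega
  have hq0 : (0 : ℝ) ≤ (m : ℝ) / (n.choose 2 : ℕ) := by positivity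
  have hq1 : (m : ℝ) / (n.choose 2 : ℕ) ≤ 1 := by
    rw [div_le_one hNr]
    exact_mod_cast hmN'
  rw [russoSlice n _ f, Finset.mul_sum]
  refine (stub_sliceCoupling n m _ hq0 hq1 hmN' f).trans (Finset.sum_le_sum fun s hs => ?_)
  rw [Finset.mem_range] at hs
  refine term_bound (Nat.cast_nonneg _) ?_ ?_
  · exact mul_pos (by exact_mod_cast Nat.choose_pos hs.le) (by exact_mod_cast Nat.sub_pos_of_lt hs)
  · obtain ⟨hlo, hhi⟩ := hratio (n.choose 2) m s hm1 hmN hs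
    split_ifs with hsm
    · exact hlo hsm
    · exact hhi (not_lt.1 hsm)

/-! ## Proved glue I-b: `q·I_q = E[#present pivotal]`, and the clique budget (v1's `stub_cliqueInfluence`, now proved) -/

/-- `q · I_q(f)` as the mass of the boundary pairs read at their UPPER endpoint: multiplying the
boundary form `disagree_eq_boundary` by `q` turns the weight of `x` (edge `e` absent) into the weight
of `x + e`; then re-index `x ↦ x + e`. Valid for every real `q`. [folklore] -/
theorem mul_influence_eq_sum_upper {n : ℕ} (q : ℝ) (f : ((⊤ : SimpleGraph (Fin n)).edgeSet → Bool) → Bool) :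
    q * ∑ e : (⊤ : SimpleGraph (Fin n)).edgeSet,
        gnpDisagreeProb n q f (fun x => f (Function.update x e (!x e)))
      = ∑ e : (⊤ : SimpleGraph (Fin n)).edgeSet,
          ∑ y ∈ univ.filter (fun y : (⊤ : SimpleGraph (Fin n)).edgeSet → Bool =>
              y e = true ∧ f (Function.update y e false) ≠ f y),
            gnpWeight n q y := by
  classical
  rw [Finset.mul_sum]
  refine Finset.sum_congr rfl fun e _ => ?_
  rw [disagree_eq_boundary q f e, Finset.mul_sum]
  -- first rewrite each term as the weight of `x + e`
  have hterm : ∀ x ∈ univ.filter (fun x : (⊤ : SimpleGraph (Fin n)).edgeSet → Bool =>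
        x e = false ∧ f x ≠ f (Function.update x e true)),
      q * (q ^ edgeCount x * (1 - q) ^ (n.choose 2 - 1 - edgeCount x)) =
        gnpWeight n q (Function.update x e true) := by
    intro x hx
    have hxe : x e = false := ((Finset.mem_filter.1 hx).2).1
    obtain ⟨hc, hle⟩ := edgeCount_update_true x e hxe
    unfold gnpWeight
    rw [hc]
    have h2 : n.choose 2 - (edgeCount x + 1) = n.choose 2 - 1 - edgeCount x := by omega
    rw [h2, pow_succ]
    ring
  rw [Finset.sum_congr rfl hterm]
  -- then re-index `x ↦ x + e`
  refine Finset.sum_nbij' (fun x => Function.update x e true) (fun y => Function.update y e false)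
    ?_ ?_ ?_ ?_ ?_
  · intro x hx
    simp only [Finset.mem_filter, Finset.mem_univ, true_and] at hx ⊢
    obtain ⟨hxe, hne⟩ := hx
    have hx1 : Function.update x e false = x := Function.update_eq_self_iff.2 hxe.symm
    refine ⟨by simp, ?_⟩
    rw [Function.update_idem, hx1]
    exact hne
  · intro y hy
    simp only [Finset.mem_filter, Finset.mem_univ, true_and] at hy ⊢
    obtain ⟨hye, hne⟩ := hy
    have hy1 : Function.update y e true = y := Function.update_eq_self_iff.2 hye.symm
    refine ⟨by simp, ?_⟩
    rw [Function.update_idem, hy1]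
    exact hne
  · intro x hx
    simp only [Finset.mem_filter, Finset.mem_univ, true_and] at hx
    have hx1 : Function.update x e false = x := Function.update_eq_self_iff.2 hx.1.symm
    rw [Function.update_idem, hx1]
  · intro y hy
    simp only [Finset.mem_filter, Finset.mem_univ, true_and] at hy
    have hy1 : Function.update y e true = y := Function.update_eq_self_iff.2 hy.1.symm
    rw [Function.update_idem, hy1]
  · intro x _
    rfl

/-- **`q · I_q(f) = E_{μ_q}[#{present pivotal edges}]`** (Russo–Margulis read at the present endpoint;
for monotone `f` this is the usual "`q ·` influence = expected number of present pivotal coordinates").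
An exact finite identity, every real `q`. [cite: ODonnell2014 §8.4 (Margulis–Russo formula)] -/
theorem mul_influence_eq_expect_presentPivotal {n : ℕ} (q : ℝ)
    (f : ((⊤ : SimpleGraph (Fin n)).edgeSet → Bool) → Bool) :
    q * ∑ e : (⊤ : SimpleGraph (Fin n)).edgeSet,
        gnpDisagreeProb n q f (fun x => f (Function.update x e (!x e)))
      = ∑ y : (⊤ : SimpleGraph (Fin n)).edgeSet → Bool, gnpWeight n q y *
          #(univ.filter fun e : (⊤ : SimpleGraph (Fin n)).edgeSet =>
              y e = true ∧ f (Function.update y e false) ≠ f y) := by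
  classical
  rw [mul_influence_eq_sum_upper]
  simp only [Finset.sum_filter]
  rw [Finset.sum_comm]
  refine Finset.sum_congr rfl fun y _ => ?_
  rw [← Finset.sum_filter, Finset.sum_const, nsmul_eq_mul, mul_comm]


/-- **Present pivotal edges of `k`-CLIQUE lie in every `k`-clique** (the pointwise budget of the
target, triage check C4; this was `stub_cliqueInfluence`'s combinatorial core in v1, now PROVED): for
every edge vector `y`, the on-edges `e` with `CLIQUE_k(y − e) ≠ CLIQUE_k(y)` number at most `C(k,2)` —
if `y` has no `k`-clique nothing is pivotal (monotonicity, `cliqueFn_monotone_holds`); if `K_A ⊆ G(y)`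
with `|A| = k` (`cliqueCount_ne_zero_iff`) then removing an edge outside `K_A` keeps `K_A`, so every
present pivotal edge is an edge of `K_A` (`card_filter_cliqueVec`). [folklore] -/
theorem cliquePivotal (n k : ℕ) (y : (⊤ : SimpleGraph (Fin n)).edgeSet → Bool) :
    #(univ.filter fun e : (⊤ : SimpleGraph (Fin n)).edgeSet =>
        y e = true ∧ cliqueFn n k (Function.update y e false) ≠ cliqueFn n k y) ≤ k.choose 2 := by
  classical
  cases hy : cliqueFn n k y
  · -- no `k`-clique: switching an edge off changes nothing (monotonicity)
    have hempty : (univ.filter fun e : (⊤ : SimpleGraph (Fin n)).edgeSet =>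
        y e = true ∧ cliqueFn n k (Function.update y e false) ≠ false) = ∅ := by
      refine Finset.filter_eq_empty_iff.2 fun e _ h => h.2 ?_
      have hle : Function.update y e false ≤ y := by
        intro e'
        by_cases h' : e' = e
        · subst h'
          simp
        · rw [Function.update_of_ne h']
      have himp := Bool.le_iff_imp.1 (cliqueFn_monotone_holds n k hle)
      rw [hy] at himp
      rcases Bool.eq_false_or_eq_true (cliqueFn n k (Function.update y e false)) with h2 | h2 <;>
        first
        | exact h2
        | exact absurd (himp h2) Bool.false_ne_true
    rw [hempty, Finset.card_empty]
    exact Nat.zero_le _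
  · -- a `k`-clique `A` of `y`: every present pivotal edge lies inside `A`
    have hne : cliqueCount n k y ≠ 0 := (cliqueCount_ne_zero_iff y).2 hy
    unfold cliqueCount at hne
    obtain ⟨A, hA⟩ := Finset.card_ne_zero.1 hne
    rw [Finset.mem_filter, Finset.mem_powersetCard] at hA
    obtain ⟨⟨-, hAk⟩, hAy⟩ := hA
    have hsub : (univ.filter fun e : (⊤ : SimpleGraph (Fin n)).edgeSet =>
        y e = true ∧ cliqueFn n k (Function.update y e false) ≠ true) ⊆
        univ.filter (fun e : (⊤ : SimpleGraph (Fin n)).edgeSet => cliqueVec A e = true) := by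
      intro e he
      rw [Finset.mem_filter] at he ⊢
      refine ⟨Finset.mem_univ _, ?_⟩
      obtain ⟨-, -, hpiv⟩ := he
      by_contra hAe
      apply hpiv
      rw [← cliqueCount_ne_zero_iff]
      unfold cliqueCount
      refine Finset.card_ne_zero.2 ⟨A, ?_⟩
      rw [Finset.mem_filter, Finset.mem_powersetCard]
      refine ⟨⟨Finset.subset_univ _, hAk⟩, fun e' he' => ?_⟩
      by_cases h' : e' = e
      · subst h'
        exact absurd he' hAe
      · rw [Function.update_of_ne h']
        exact hAy e' he'
    calc #(univ.filter fun e : (⊤ : SimpleGraph (Fin n)).edgeSet =>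
            y e = true ∧ cliqueFn n k (Function.update y e false) ≠ true)
        ≤ #(univ.filter fun e : (⊤ : SimpleGraph (Fin n)).edgeSet => cliqueVec A e = true) :=
          Finset.card_le_card hsub
      _ = (#A).choose 2 := card_filter_cliqueVec A
      _ = k.choose 2 := by rw [hAk]

/-- **Influence budget of `k`-CLIQUE (v1's `stub_cliqueInfluence`, now PROVED):**
`q · I_q(CLIQUE_k) ≤ C(k,2)` for every `0 ≤ q ≤ 1` — by `mul_influence_eq_expect_presentPivotal` the
left side is `Σ_y μ_q(y) · #{present pivotal edges of y}`, each count is `≤ C(k,2)` (`cliquePivotal`),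
and `Σ_y μ_q(y) = 1` (`gnpProb_univ`). No density or window hypothesis.
[cite: Rossman2014 §2; ODonnell2014 §8.4 (Russo–Margulis)] -/
theorem cliqueInfluence (n k : ℕ) (q : ℝ) (hq0 : 0 ≤ q) (hq1 : q ≤ 1) :
    q * ∑ e : (⊤ : SimpleGraph (Fin n)).edgeSet,
          gnpDisagreeProb n q (cliqueFn n k) (fun x => cliqueFn n k (Function.update x e (!x e)))
      ≤ (k.choose 2 : ℝ) := by
  classical
  rw [mul_influence_eq_expect_presentPivotal]
  have hsum1 : ∑ y : (⊤ : SimpleGraph (Fin n)).edgeSet → Bool, gnpWeight n q y = 1 := gnpProb_univ n q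
  calc ∑ y : (⊤ : SimpleGraph (Fin n)).edgeSet → Bool, gnpWeight n q y *
          #(univ.filter fun e : (⊤ : SimpleGraph (Fin n)).edgeSet =>
              y e = true ∧ cliqueFn n k (Function.update y e false) ≠ cliqueFn n k y)
      ≤ ∑ y : (⊤ : SimpleGraph (Fin n)).edgeSet → Bool, gnpWeight n q y * (k.choose 2 : ℝ) :=
        Finset.sum_le_sum fun y _ =>
          mul_le_mul_of_nonneg_left (by exact_mod_cast cliquePivotal n k y) (gnpWeight_nonneg hq0 hq1 y)
    _ = (k.choose 2 : ℝ) := by rw [← Finset.sum_mul, hsum1, one_mul]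

/-! ## Proved glue II: Boppana's bound on `E(K_n)` from Stubs S4–S5 (this was v1's `stub_boppana`) -/

/-- At density `1/2` every edge vector has the same weight: `Pr_{G(n,1/2)}[f ≠ g] = #{f ≠ g}/2^{C(n,2)}`.
[folklore] -/
theorem gnpDisagreeProb_half {n : ℕ} (f g : ((⊤ : SimpleGraph (Fin n)).edgeSet → Bool) → Bool) :
    gnpDisagreeProb n (1 / 2) f g =
      (#(univ.filter fun x : (⊤ : SimpleGraph (Fin n)).edgeSet → Bool => f x ≠ g x) : ℝ) /
        2 ^ (n.choose 2) := by
  classical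
  unfold gnpDisagreeProb
  have hw : ∀ x : (⊤ : SimpleGraph (Fin n)).edgeSet → Bool,
      gnpWeight n (1 / 2) x = 1 / 2 ^ (n.choose 2) := by
    intro x
    have hle : edgeCount x ≤ n.choose 2 := by
      unfold edgeCount
      calc #(univ.filter fun e => x e = true)
          ≤ #(univ : Finset ((⊤ : SimpleGraph (Fin n)).edgeSet)) := Finset.card_filter_le _ _
        _ = n.choose 2 := by rw [Finset.card_univ, card_edgeSet_top_fin]
    unfold gnpWeight
    rw [show (1 : ℝ) - 1 / 2 = 1 / 2 by norm_num, ← pow_add, Nat.add_sub_cancel' hle, one_div_pow]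
  rw [Finset.sum_congr rfl fun x _ => hw x, Finset.sum_const, nsmul_eq_mul]
  ring

/-- Flipping a coordinate commutes with renaming the coordinates along an equivalence. [folklore] -/
theorem update_comp_equiv_apply {α β γ : Type*} [DecidableEq α] [DecidableEq β]
    (u : β → γ) (e : α ≃ β) (a : α) (v : γ) :
    (fun i => Function.update u (e a) v (e i)) = Function.update (fun i => u (e i)) a v := by
  funext i
  by_cases h : i = a
  · subst h
    simp
  · rw [Function.update_of_ne (fun h' => h (e.injective h')), Function.update_of_ne h]

/-- **Boppana's total-influence bound for AC⁰ on the edge variables of `K_n`, uniform measure (v1's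
`stub_boppana`, now PROVED from S4–S5 by transport along `E(K_n) ≃ Fin C(n,2)`).** For every `d ≥ 1`
there is `K_d` such that every circuit over `acBasis` of `acDepth ≤ d` with at most `s ≥ 2` gates has
`I(C) = Σ_e Pr_{x ~ μ_{1/2}}[C(x) ≠ C(x ⊕ e)] ≤ K_d (log s)^{d−1}`.
[cite: Boppana1997 Thm 1; LinialMansourNisan1993; Tal2017 Thm 3.6] -/
theorem boppana (d : ℕ) (hd : 1 ≤ d) :
    ∃ K : ℝ, 0 < K ∧ ∀ (n s : ℕ) (C : Circuit ((⊤ : SimpleGraph (Fin n)).edgeSet)),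
      C.IsOver acBasis → C.acDepth ≤ d → C.size ≤ s → 2 ≤ s →
      ∑ e : (⊤ : SimpleGraph (Fin n)).edgeSet,
          gnpDisagreeProb n (1 / 2) C.eval (fun x => C.eval (Function.update x e (!x e)))
        ≤ K * Real.log s ^ (d - 1) := by
  classical
  obtain ⟨K, hK, hb⟩ := stub_boppanaTail d hd
  refine ⟨K, hK, ?_⟩
  intro n s C hB hD hS hs
  -- transport the circuit to `Fin N'` inputs, `N' = |E(K_n)| = C(n,2)`
  set eq := Fintype.equivFin ((⊤ : SimpleGraph (Fin n)).edgeSet) with heq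
  set C' : Circuit (Fin (Fintype.card ((⊤ : SimpleGraph (Fin n)).edgeSet))) := C.mapInputs eq with hC'
  have hB' : C'.IsOver acBasis := hB.mapInputs _
  have hD' : C'.acDepth ≤ d := by rw [hC', Circuit.acDepth_mapInputs]; exact hD
  have hS' : C'.size ≤ s := by rw [hC', Circuit.size_mapInputs]; exact hS
  have key := hb _ s C' hB' hD' hS' hs
  rw [← stub_influenceFourier] at key
  -- the renaming of edge vectors
  let φ : (((⊤ : SimpleGraph (Fin n)).edgeSet → Bool)) ≃
      (Fin (Fintype.card ((⊤ : SimpleGraph (Fin n)).edgeSet)) → Bool) :=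
    { toFun := fun x => fun i => x (eq.symm i)
      invFun := fun u => fun e => u (eq e)
      left_inv := fun x => by funext e; simp
      right_inv := fun u => by funext i; simp }
  have hC'eval : ∀ u, C'.eval u = C.eval (fun e => u (eq e)) := fun u => by
    rw [hC', Circuit.eval_mapInputs]
  have hcard : ∀ e : (⊤ : SimpleGraph (Fin n)).edgeSet,
      #(univ.filter fun x : (⊤ : SimpleGraph (Fin n)).edgeSet → Bool =>
          C.eval x ≠ C.eval (Function.update x e (!x e))) =
      #(univ.filter fun u : Fin (Fintype.card ((⊤ : SimpleGraph (Fin n)).edgeSet)) → Bool =>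
          C'.eval u ≠ C'.eval (Function.update u (eq e) (!u (eq e)))) := by
    intro e
    refine Finset.card_equiv φ fun x => ?_
    simp only [Finset.mem_filter, Finset.mem_univ, true_and]
    have h1 : (fun e' => (φ x) (eq e')) = x := by funext e'; simp [φ]
    have h2 : (fun e' => Function.update (φ x) (eq e) (!(φ x) (eq e)) (eq e')) =
        Function.update x e (!x e) := by
      rw [update_comp_equiv_apply (φ x) eq e, h1]
      simp [φ]
    rw [hC'eval, hC'eval, h1, h2]
  have h2pow : (2 : ℝ) ^ Fintype.card ((⊤ : SimpleGraph (Fin n)).edgeSet) = 2 ^ (n.choose 2) := by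
    rw [card_edgeSet_top_fin]
  calc ∑ e : (⊤ : SimpleGraph (Fin n)).edgeSet,
          gnpDisagreeProb n (1 / 2) C.eval (fun x => C.eval (Function.update x e (!x e)))
      = ∑ e : (⊤ : SimpleGraph (Fin n)).edgeSet,
          (#(univ.filter fun x : (⊤ : SimpleGraph (Fin n)).edgeSet → Bool =>
              C.eval x ≠ C.eval (Function.update x e (!x e))) : ℝ) / 2 ^ (n.choose 2) :=
        Finset.sum_congr rfl fun e _ => gnpDisagreeProb_half _ _
    _ = ∑ i : Fin (Fintype.card ((⊤ : SimpleGraph (Fin n)).edgeSet)),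
          (#(univ.filter fun u : Fin (Fintype.card ((⊤ : SimpleGraph (Fin n)).edgeSet)) → Bool =>
              C'.eval u ≠ C'.eval (Function.update u i (!u i))) : ℝ) /
            2 ^ Fintype.card ((⊤ : SimpleGraph (Fin n)).edgeSet) := by
        rw [h2pow]
        exact Fintype.sum_equiv eq _ _ fun e => by rw [hcard e]
    _ ≤ K * Real.log s ^ (d - 1) := key

/-! ## Proved glue III: XOR-subadditivity of the influence budget and the SLICE GAP -/

/-- `Pr[G(n,q) ∈ S ∪ T] ≤ Pr[S] + Pr[T]` (union bound for the finite `G(n,q)` sums). [folklore] -/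
theorem gnpProb_union_le {n : ℕ} {q : ℝ} (hq0 : 0 ≤ q) (hq1 : q ≤ 1)
    (S T : Finset ((⊤ : SimpleGraph (Fin n)).edgeSet → Bool)) :
    gnpProb n q (S ∪ T) ≤ gnpProb n q S + gnpProb n q T := by
  classical
  unfold gnpProb
  have h := Finset.sum_union_inter (s₁ := S) (s₂ := T) (f := fun x => gnpWeight n q x)
  have hnn : 0 ≤ ∑ x ∈ S ∩ T, gnpWeight n q x := sum_nonneg fun x _ => gnpWeight_nonneg hq0 hq1 x
  linarith

/-- **XOR-subadditivity of pivotality**: if `g = [f ≠ h]` pointwise then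
`I_q(g) ≤ I_q(f) + I_q(h)` — an edge pivotal for `g` at `x` is pivotal for `f` or for `h` at `x`,
and the `G(n,q)` weights are nonnegative. [folklore] -/
theorem infl_le_of_bne {n : ℕ} (q : ℝ) (hq0 : 0 ≤ q) (hq1 : q ≤ 1)
    (f h g : ((⊤ : SimpleGraph (Fin n)).edgeSet → Bool) → Bool)
    (hg : ∀ x, g x = (f x != h x)) :
    ∑ e : (⊤ : SimpleGraph (Fin n)).edgeSet,
        gnpDisagreeProb n q g (fun x => g (Function.update x e (!x e)))
      ≤ ∑ e : (⊤ : SimpleGraph (Fin n)).edgeSet,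
          gnpDisagreeProb n q f (fun x => f (Function.update x e (!x e))) +
        ∑ e : (⊤ : SimpleGraph (Fin n)).edgeSet,
          gnpDisagreeProb n q h (fun x => h (Function.update x e (!x e))) := by
  classical
  rw [← Finset.sum_add_distrib]
  refine Finset.sum_le_sum fun e _ => ?_
  have hsub : (univ.filter fun x : (⊤ : SimpleGraph (Fin n)).edgeSet → Bool =>
        g x ≠ g (Function.update x e (!x e))) ⊆
      (univ.filter fun x : (⊤ : SimpleGraph (Fin n)).edgeSet → Bool =>
          f x ≠ f (Function.update x e (!x e))) ∪
        (univ.filter fun x : (⊤ : SimpleGraph (Fin n)).edgeSet → Bool =>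
          h x ≠ h (Function.update x e (!x e))) := by
    intro x hx
    rw [Finset.mem_union, Finset.mem_filter, Finset.mem_filter]
    rw [Finset.mem_filter] at hx
    by_contra hcon
    rw [not_or] at hcon
    have h1 : f x = f (Function.update x e (!x e)) := by
      by_contra h1
      exact hcon.1 ⟨Finset.mem_univ _, h1⟩
    have h2 : h x = h (Function.update x e (!x e)) := by
      by_contra h2
      exact hcon.2 ⟨Finset.mem_univ _, h2⟩
    exact hx.2 (by rw [hg, hg, ← h1, ← h2])
  calc gnpDisagreeProb n q g (fun x => g (Function.update x e (!x e)))
      = gnpProb n q (univ.filter fun x : (⊤ : SimpleGraph (Fin n)).edgeSet → Bool =>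
          g x ≠ g (Function.update x e (!x e))) := rfl
    _ ≤ gnpProb n q ((univ.filter fun x : (⊤ : SimpleGraph (Fin n)).edgeSet → Bool =>
            f x ≠ f (Function.update x e (!x e))) ∪
          (univ.filter fun x : (⊤ : SimpleGraph (Fin n)).edgeSet → Bool =>
            h x ≠ h (Function.update x e (!x e)))) := gnpProb_mono hq0 hq1 hsub
    _ ≤ _ := gnpProb_union_le hq0 hq1 _ _

/-- **Biased influence budget of AC⁰ (proved from Stub S3 and `boppana`).** For every `d` there is `K`
with `q · I_q(C) ≤ K (log s)^{d−1}` for every circuit over `acBasis` of `acDepth ≤ d`, size `≤ s`,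
`s ≥ 2`, and every `0 < q ≤ 1/2`: by the AND-coin identity `q·I_q(C)` is half the `μ_{2q}`-average over
`y` of the uniform influence of `z ↦ C(y ∧ z)`, which is computed by the restricted circuit
(`Circuit.exists_restrict`, inputs with `y_e = 0` hard-wired to `0`: over `acBasis`, size `≤ max s 1 = s`,
`acDepth ≤ max d 1`), so `boppana` at depth `max d 1 ≥ 1` bounds every term by
`K (log s)^{max d 1 − 1} = K (log s)^{d−1}`, and the weights sum to `1` (`gnpProb_univ`). [folklore] -/
theorem acInfluence (d : ℕ) :
    ∃ K : ℝ, 0 < K ∧ ∀ (n s : ℕ) (q : ℝ) (C : Circuit ((⊤ : SimpleGraph (Fin n)).edgeSet)),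
      C.IsOver acBasis → C.acDepth ≤ d → C.size ≤ s → 2 ≤ s → 0 < q → q ≤ 1 / 2 →
      q * ∑ e : (⊤ : SimpleGraph (Fin n)).edgeSet,
            gnpDisagreeProb n q C.eval (fun x => C.eval (Function.update x e (!x e)))
        ≤ K * Real.log s ^ (d - 1) := by
  classical
  obtain ⟨K, hK, hb⟩ := boppana (max d 1) (le_max_right _ _)
  refine ⟨K / 2, by positivity, ?_⟩
  intro n s q C hB hD hS hs hq0 hq1
  have hdm : max d 1 - 1 = d - 1 := by omega
  have h2q0 : 0 ≤ 2 * q := by linarith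
  have h2q1 : 2 * q ≤ 1 := by linarith
  rw [stub_andCoin n q hq0.le hq1 C.eval]
  -- every restricted test obeys `boppana`
  have hy : ∀ y : (⊤ : SimpleGraph (Fin n)).edgeSet → Bool,
      ∑ e : (⊤ : SimpleGraph (Fin n)).edgeSet,
          gnpDisagreeProb n (1 / 2) (fun z => C.eval (fun i => y i && z i))
            (fun z => C.eval (fun i => y i && Function.update z e (!z e) i))
        ≤ K * Real.log s ^ (d - 1) := by
    intro y
    obtain ⟨C', hB', hS', hD', hev⟩ :=
      C.exists_restrict hB (fun i => if y i = true then none else some false)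
    have hres : ∀ z : (⊤ : SimpleGraph (Fin n)).edgeSet → Bool,
        restrictInput (fun i => if y i = true then none else some false) z = fun i => y i && z i := by
      intro z
      funext i
      unfold restrictInput
      rcases Bool.eq_false_or_eq_true (y i) with h | h <;> simp [h]
    have hE : C'.eval = fun z => C.eval (fun i => y i && z i) := by
      funext z
      rw [hev, hres]
    have hb' := hb n s C' hB' (hD'.trans (max_le_max hD le_rfl)) (hS'.trans (max_le hS (by omega))) hs
    rw [hdm, hE] at hb'
    exact hb'
  have hw : ∀ y : (⊤ : SimpleGraph (Fin n)).edgeSet → Bool, 0 ≤ gnpWeight n (2 * q) y :=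
    fun y => gnpWeight_nonneg h2q0 h2q1 y
  have hsum1 : ∑ y : (⊤ : SimpleGraph (Fin n)).edgeSet → Bool, gnpWeight n (2 * q) y = 1 :=
    gnpProb_univ n (2 * q)
  calc 1 / 2 * ∑ y : (⊤ : SimpleGraph (Fin n)).edgeSet → Bool, gnpWeight n (2 * q) y *
          ∑ e : (⊤ : SimpleGraph (Fin n)).edgeSet,
            gnpDisagreeProb n (1 / 2) (fun z => C.eval (fun i => y i && z i))
              (fun z => C.eval (fun i => y i && Function.update z e (!z e) i))
      ≤ 1 / 2 * ∑ y : (⊤ : SimpleGraph (Fin n)).edgeSet → Bool,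
          gnpWeight n (2 * q) y * (K * Real.log s ^ (d - 1)) := by
        refine mul_le_mul_of_nonneg_left (Finset.sum_le_sum fun y _ => ?_) (by norm_num)
        exact mul_le_mul_of_nonneg_left (hy y) (hw y)
    _ = 1 / 2 * (K * Real.log s ^ (d - 1)) *
          ∑ y : (⊤ : SimpleGraph (Fin n)).edgeSet → Bool, gnpWeight n (2 * q) y := by
        rw [← Finset.sum_mul]
        ring
    _ = K / 2 * Real.log s ^ (d - 1) := by
        rw [hsum1]
        ring
/-- **SLICE GAP (the line's C⁺, proved from Stubs S1–S5).** For all `d c k` there are `K₁, K₂ ≥ 0` such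
that for `1 ≤ j ≤ N/2` and every circuit over `acBasis` of `acDepth ≤ d` and size `≤ n^c`, the
fraction of the slice `G(n,j)` on which `C ≠ CLIQUE_k` differs from `Pr_{G(n,j/N)}[C ≠ CLIQUE_k]` by at
most `(K₁ (log(n+2))^{d−1} + K₂)/√j`. Proof: `hybrid` for `g = [C ≠ CLIQUE_k]`,
`I_q(g) ≤ I_q(C) + I_q(CLIQUE_k)` (`infl_le_of_bne`), `acInfluence` (with `s = (n+2)^{c+1}`) and
`cliqueInfluence` at `q = j/N ≤ 1/2`, and `(√j/N) · (N/j) = 1/√j`; `K₁ = K·K_d·(c+1)^{d−1}`, `K₂ = K·C(k,2)`. [folklore] -/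
theorem sliceGap (d c k : ℕ) : ∃ K₁ K₂ : ℝ, 0 ≤ K₁ ∧ 0 ≤ K₂ ∧ ∀ (n j : ℕ)
      (C : Circuit ((⊤ : SimpleGraph (Fin n)).edgeSet)),
      1 ≤ j → 2 * j ≤ n.choose 2 → C.IsOver acBasis → C.acDepth ≤ d → C.size ≤ n ^ c →
      |(#(univ.filter fun x : (⊤ : SimpleGraph (Fin n)).edgeSet → Bool =>
            edgeCount x = j ∧ C.eval x ≠ cliqueFn n k x) : ℝ) /
          #(univ.filter fun x : (⊤ : SimpleGraph (Fin n)).edgeSet → Bool => edgeCount x = j)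
        - gnpDisagreeProb n ((j : ℝ) / (n.choose 2 : ℕ)) C.eval (cliqueFn n k)|
      ≤ (K₁ * Real.log ((n : ℝ) + 2) ^ (d - 1) + K₂) / Real.sqrt j := by
  classical
  obtain ⟨K, hK, hhyb⟩ := hybrid
  obtain ⟨Ka, hKa, hac⟩ := acInfluence d
  refine ⟨K * (Ka * ((c : ℝ) + 1) ^ (d - 1)), K * (k.choose 2 : ℝ), by positivity, by positivity, ?_⟩
  intro n j C hj1 hjN hB hD hS
  -- the matched density `j/N ∈ (0, 1/2]`
  have hNpos : 0 < n.choose 2 := by omega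
  have hNr : (0 : ℝ) < (n.choose 2 : ℕ) := by exact_mod_cast hNpos
  have hjr : (0 : ℝ) < (j : ℝ) := by exact_mod_cast hj1
  have hq0 : (0 : ℝ) < (j : ℝ) / (n.choose 2 : ℕ) := div_pos hjr hNr
  have hqhalf : (j : ℝ) / (n.choose 2 : ℕ) ≤ 1 / 2 := by
    rw [div_le_iff₀ hNr]
    have h2j : (2 : ℝ) * j ≤ ((n.choose 2 : ℕ) : ℝ) := by exact_mod_cast hjN
    linarith
  have hq1 : (j : ℝ) / (n.choose 2 : ℕ) ≤ 1 := hqhalf.trans (by norm_num)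
  -- the error indicator `g = [C ≠ CLIQUE_k]`
  obtain ⟨g, hg⟩ : ∃ g : ((⊤ : SimpleGraph (Fin n)).edgeSet → Bool) → Bool,
      ∀ x, g x = (C.eval x != cliqueFn n k x) := ⟨_, fun _ => rfl⟩
  have hA : (univ.filter fun x : (⊤ : SimpleGraph (Fin n)).edgeSet → Bool =>
        edgeCount x = j ∧ C.eval x ≠ cliqueFn n k x) =
      univ.filter (fun x : (⊤ : SimpleGraph (Fin n)).edgeSet → Bool =>
        edgeCount x = j ∧ g x = true) := by
    refine Finset.filter_congr fun x _ => ?_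
    rw [hg]
    simp
  have hBq : gnpDisagreeProb n ((j : ℝ) / (n.choose 2 : ℕ)) C.eval (cliqueFn n k) =
      gnpProb n ((j : ℝ) / (n.choose 2 : ℕ)) (univ.filter fun x => g x = true) := by
    unfold gnpDisagreeProb gnpProb
    refine Finset.sum_congr (Finset.filter_congr fun x _ => ?_) fun _ _ => rfl
    rw [hg]
    simp
  rw [hA, hBq]
  -- `hybrid` for `g`, XOR-subadditivity, `acInfluence` with `s = (n+2)^(c+1)`, `cliqueInfluence`
  have h1 := hhyb n j g hj1 hjN
  have hsub := infl_le_of_bne ((j : ℝ) / (n.choose 2 : ℕ)) hq0.le hq1 C.eval (cliqueFn n k) g hg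
  have hs2 : 2 ≤ (n + 2) ^ (c + 1) := by
    calc 2 ≤ n + 2 := by omega
      _ = (n + 2) ^ 1 := (pow_one _).symm
      _ ≤ (n + 2) ^ (c + 1) := Nat.pow_le_pow_right (by omega) (by omega)
  have hsize : C.size ≤ (n + 2) ^ (c + 1) := by
    calc C.size ≤ n ^ c := hS
      _ ≤ (n + 2) ^ c := Nat.pow_le_pow_left (by omega) c
      _ ≤ (n + 2) ^ (c + 1) := Nat.pow_le_pow_right (by omega) (by omega)
  have h2 := hac n ((n + 2) ^ (c + 1)) ((j : ℝ) / (n.choose 2 : ℕ)) C hB hD hsize hs2 hq0 hqhalf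
  have hlog : Real.log (((n + 2) ^ (c + 1) : ℕ) : ℝ) = ((c : ℝ) + 1) * Real.log ((n : ℝ) + 2) := by
    push_cast
    rw [Real.log_pow]
    push_cast
    ring
  rw [hlog, mul_pow] at h2
  have h3 := cliqueInfluence n k ((j : ℝ) / (n.choose 2 : ℕ)) hq0.le hq1
  -- names
  set q : ℝ := (j : ℝ) / (n.choose 2 : ℕ) with hq
  set L : ℝ := Real.log ((n : ℝ) + 2) with hL
  set Ig : ℝ := ∑ e : (⊤ : SimpleGraph (Fin n)).edgeSet,
      gnpDisagreeProb n q g (fun x => g (Function.update x e (!x e))) with hIg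
  set IC : ℝ := ∑ e : (⊤ : SimpleGraph (Fin n)).edgeSet,
      gnpDisagreeProb n q C.eval (fun x => C.eval (Function.update x e (!x e))) with hIC
  set Icl : ℝ := ∑ e : (⊤ : SimpleGraph (Fin n)).edgeSet,
      gnpDisagreeProb n q (cliqueFn n k)
        (fun x => cliqueFn n k (Function.update x e (!x e))) with hIcl
  set A : ℝ := Ka * ((c : ℝ) + 1) ^ (d - 1) * L ^ (d - 1) + (k.choose 2 : ℝ) with hAdef
  -- assemble
  have hqsum : q * (IC + Icl) ≤ A := by
    rw [mul_add, hAdef]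
    refine add_le_add ?_ h3
    calc q * IC ≤ Ka * (((c : ℝ) + 1) ^ (d - 1) * L ^ (d - 1)) := h2
      _ = Ka * ((c : ℝ) + 1) ^ (d - 1) * L ^ (d - 1) := by ring
  have hIgA : Ig ≤ A / q := by
    rw [le_div_iff₀ hq0]
    calc Ig * q = q * Ig := mul_comm _ _
      _ ≤ q * (IC + Icl) := mul_le_mul_of_nonneg_left hsub hq0.le
      _ ≤ A := hqsum
  have hcoef : 0 ≤ K * (Real.sqrt j / (n.choose 2 : ℕ)) :=
    mul_nonneg hK.le (div_nonneg (Real.sqrt_nonneg _) hNr.le)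
  have hN0 : ((n.choose 2 : ℕ) : ℝ) ≠ 0 := hNr.ne'
  have hj0 : (j : ℝ) ≠ 0 := hjr.ne'
  have key : Real.sqrt j / (n.choose 2 : ℕ) * (A / q) = A * (1 / Real.sqrt j) := by
    rw [← Real.sqrt_div_self', hq]
    field_simp
  calc |(#(univ.filter fun x : (⊤ : SimpleGraph (Fin n)).edgeSet → Bool =>
            edgeCount x = j ∧ g x = true) : ℝ) /
          #(univ.filter fun x : (⊤ : SimpleGraph (Fin n)).edgeSet → Bool => edgeCount x = j)
        - gnpProb n q (univ.filter fun x => g x = true)|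
      ≤ K * (Real.sqrt j / (n.choose 2 : ℕ)) * Ig := h1
    _ ≤ K * (Real.sqrt j / (n.choose 2 : ℕ)) * (A / q) := mul_le_mul_of_nonneg_left hIgA hcoef
    _ = K * (Real.sqrt j / (n.choose 2 : ℕ) * (A / q)) := by ring
    _ = K * (A * (1 / Real.sqrt j)) := by rw [key]
    _ = (K * (Ka * ((c : ℝ) + 1) ^ (d - 1)) * L ^ (d - 1) + K * (k.choose 2 : ℝ)) / Real.sqrt j := by
        rw [hAdef]
        ring

/-! ## Proved glue: the critical window is deep and narrow -/

/-- **Polylog over root is small**: for `K₁, K₂ ≥ 0`, `ε > 0` and every exponent `e`, eventually in `n`,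
`(K₁ (log(n+2))^e + K₂)/√j ≤ ε` for every `j ≥ n/8`, `j ≥ 1`. [folklore] -/
theorem rate_small (e : ℕ) (K₁ K₂ ε : ℝ) (hK₁ : 0 ≤ K₁) (hK₂ : 0 ≤ K₂) (hε : 0 < ε) :
    ∀ᶠ n : ℕ in atTop, ∀ j : ℕ, (n : ℝ) ≤ 8 * j → 1 ≤ j →
      (K₁ * Real.log ((n : ℝ) + 2) ^ e + K₂) / Real.sqrt j ≤ ε := by
  have hc : (0 : ℝ) < 1 / (4 * ((e : ℝ) + 1)) := by positivity
  have hlog := eventually_log_le_mul_rpow hc one_pos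
  have hconst := eventually_const_le_mul_rpow (c := 1 / 4) (by norm_num) hε
    ((K₁ * 2 ^ e + K₂) * Real.sqrt 8)
  filter_upwards [hlog, hconst, eventually_ge_atTop 2] with n hlogn hconstn hn2
  intro j hnj hj1
  have hn : (2 : ℝ) ≤ n := by exact_mod_cast hn2
  have hn0 : (0 : ℝ) < n := by linarith
  have hn1 : (1 : ℝ) ≤ n := by linarith
  have hjr : (1 : ℝ) ≤ j := by exact_mod_cast hj1
  have hj0 : (0 : ℝ) < j := by linarith
  -- log (n+2) ≤ 2 log n ≤ 2 n^c
  have hl2 : Real.log ((n : ℝ) + 2) ≤ 2 * Real.log n := by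
    calc Real.log ((n : ℝ) + 2) ≤ Real.log ((n : ℝ) ^ 2) :=
          Real.log_le_log (by linarith) (by nlinarith)
      _ = 2 * Real.log n := by rw [Real.log_pow]; push_cast; ring
  have hlog0 : 0 ≤ Real.log ((n : ℝ) + 2) := Real.log_nonneg (by linarith)
  have hlc : Real.log ((n : ℝ) + 2) ≤ 2 * (n : ℝ) ^ (1 / (4 * ((e : ℝ) + 1))) := by
    linarith [hlogn]
  have hpow : Real.log ((n : ℝ) + 2) ^ e ≤ 2 ^ e * (n : ℝ) ^ ((1 : ℝ) / 4) := by
    calc Real.log ((n : ℝ) + 2) ^ e ≤ (2 * (n : ℝ) ^ (1 / (4 * ((e : ℝ) + 1)))) ^ e :=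
          pow_le_pow_left₀ hlog0 hlc e
      _ = 2 ^ e * (n : ℝ) ^ (1 / (4 * ((e : ℝ) + 1)) * e) := by
          rw [mul_pow, Real.rpow_mul_natCast hn0.le]
      _ ≤ 2 ^ e * (n : ℝ) ^ ((1 : ℝ) / 4) := by
          refine mul_le_mul_of_nonneg_left (Real.rpow_le_rpow_of_exponent_le hn1 ?_) (by positivity)
          rw [div_mul_eq_mul_div, one_mul, div_le_div_iff₀ (by positivity) (by norm_num)]
          nlinarith
  -- the numerator is at most (K₁ 2^e + K₂) n^{1/4}
  have hquart1 : 1 ≤ (n : ℝ) ^ ((1 : ℝ) / 4) := Real.one_le_rpow hn1 (by norm_num)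
  have hnum : K₁ * Real.log ((n : ℝ) + 2) ^ e + K₂ ≤ (K₁ * 2 ^ e + K₂) * (n : ℝ) ^ ((1 : ℝ) / 4) := by
    have h1 : K₁ * Real.log ((n : ℝ) + 2) ^ e ≤ K₁ * (2 ^ e * (n : ℝ) ^ ((1 : ℝ) / 4)) :=
      mul_le_mul_of_nonneg_left hpow hK₁
    have h2 : K₂ ≤ K₂ * (n : ℝ) ^ ((1 : ℝ) / 4) := le_mul_of_one_le_right hK₂ hquart1
    nlinarith
  -- √j ≥ √(n/8) = n^{1/4} n^{1/4} / √8
  have hsq : Real.sqrt n = (n : ℝ) ^ ((1 : ℝ) / 4) * (n : ℝ) ^ ((1 : ℝ) / 4) := by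
    rw [Real.sqrt_eq_rpow, ← Real.rpow_add hn0]
    norm_num
  have h8 : (0 : ℝ) < Real.sqrt 8 := Real.sqrt_pos.2 (by norm_num)
  have hsj : Real.sqrt ((n : ℝ) / 8) ≤ Real.sqrt j := Real.sqrt_le_sqrt (by linarith)
  have hsj' : Real.sqrt ((n : ℝ) / 8) = (n : ℝ) ^ ((1 : ℝ) / 4) * (n : ℝ) ^ ((1 : ℝ) / 4) / Real.sqrt 8 := by
    rw [Real.sqrt_div' _ (by norm_num : (0 : ℝ) ≤ 8), hsq]
  have hq0 : 0 ≤ (n : ℝ) ^ ((1 : ℝ) / 4) := Real.rpow_nonneg hn0.le _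
  have hmain : (K₁ * 2 ^ e + K₂) * (n : ℝ) ^ ((1 : ℝ) / 4) ≤ ε * Real.sqrt ((n : ℝ) / 8) := by
    rw [hsj', show ε * ((n : ℝ) ^ ((1 : ℝ) / 4) * (n : ℝ) ^ ((1 : ℝ) / 4) / Real.sqrt 8) =
      (ε * (n : ℝ) ^ ((1 : ℝ) / 4) * (n : ℝ) ^ ((1 : ℝ) / 4)) / Real.sqrt 8 by ring,
      le_div_iff₀ h8]
    have := mul_le_mul_of_nonneg_right hconstn hq0
    nlinarith
  rw [div_le_iff₀ (Real.sqrt_pos.2 hj0)]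
  calc K₁ * Real.log ((n : ℝ) + 2) ^ e + K₂ ≤ (K₁ * 2 ^ e + K₂) * (n : ℝ) ^ ((1 : ℝ) / 4) := hnum
    _ ≤ ε * Real.sqrt ((n : ℝ) / 8) := hmain
    _ ≤ ε * Real.sqrt j := mul_le_mul_of_nonneg_left hsj hε.le

/-- **The critical window is deep and narrow**: for `k ≥ 3`, eventually in `n`, every `j` with
`|j − m_k(n)| ≤ m_k(n)^{3/4}` (`m_k(n) = ⌊C(n,2) · n^{−2/(k−1)}⌋`) satisfies `n ≤ 8j`, `1 ≤ j` and
`2j ≤ C(n,2)`: indeed `m_k(n) ≥ C(n,2) n^{−1} − 1 = (n−3)/2` (as `2/(k−1) ≤ 1`), `m ≥ 16` gives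
`m^{3/4} ≤ m/2`, and `n^{−2/(k−1)} ≤ 1/4` gives `m ≤ C(n,2)/4`. [folklore] -/
theorem window_bounds (k : ℕ) (hk : 3 ≤ k) :
    ∀ᶠ n : ℕ in atTop, ∀ j : ℕ,
      |(j : ℝ) - (⌊((n.choose 2 : ℕ) : ℝ) * (n : ℝ) ^ (-(2 : ℝ) / ((k : ℝ) - 1))⌋₊ : ℝ)| ≤
        (⌊((n.choose 2 : ℕ) : ℝ) * (n : ℝ) ^ (-(2 : ℝ) / ((k : ℝ) - 1))⌋₊ : ℝ) ^ ((3 : ℝ) / 4) →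
      (n : ℝ) ≤ 8 * j ∧ 1 ≤ j ∧ 2 * j ≤ n.choose 2 := by
  have hk3 : (3 : ℝ) ≤ k := by exact_mod_cast hk
  set α : ℝ := (2 : ℝ) / ((k : ℝ) - 1) with hα
  have hα0 : 0 < α := by rw [hα]; exact div_pos (by norm_num) (by linarith)
  have hα1 : α ≤ 1 := by
    rw [hα, div_le_one (by linarith)]
    linarith
  have hsmall := eventually_mul_rpow_neg_lt hα0 (ε := 1 / 4) (by norm_num) 1
  filter_upwards [hsmall, eventually_ge_atTop 40] with n hsm hn40
  intro j hj
  have hn : (40 : ℝ) ≤ n := by exact_mod_cast hn40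
  have hn0 : (0 : ℝ) < n := by linarith
  have hn1 : (1 : ℝ) ≤ n := by linarith
  have hneg : -(2 : ℝ) / ((k : ℝ) - 1) = -α := by rw [hα]; ring
  rw [hneg] at hj
  set Nr : ℝ := ((n.choose 2 : ℕ) : ℝ) with hNr
  have hNr0 : 0 ≤ Nr := Nat.cast_nonneg _
  set x : ℝ := Nr * (n : ℝ) ^ (-α) with hx
  have hx0 : 0 ≤ x := mul_nonneg hNr0 (Real.rpow_nonneg hn0.le _)
  have hmx : (⌊x⌋₊ : ℝ) ≤ x := Nat.floor_le hx0
  have hxm : x < (⌊x⌋₊ : ℝ) + 1 := Nat.lt_floor_add_one x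
  -- x ≥ N/n = (n-1)/2
  have hNn : Nr * (n : ℝ) ^ (-(1 : ℝ)) = ((n : ℝ) - 1) / 2 := by
    rw [hNr, Nat.cast_choose_two, Real.rpow_neg_one]
    field_simp
  have hxlow : ((n : ℝ) - 1) / 2 ≤ x := by
    rw [← hNn, hx]
    exact mul_le_mul_of_nonneg_left
      (Real.rpow_le_rpow_of_exponent_le hn1 (by linarith)) hNr0
  -- x ≤ N/4
  have hxup : x ≤ Nr / 4 := by
    have h4 : (n : ℝ) ^ (-α) ≤ 1 / 4 := by linarith [hsm]
    calc x = Nr * (n : ℝ) ^ (-α) := hx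
      _ ≤ Nr * (1 / 4) := mul_le_mul_of_nonneg_left h4 hNr0
      _ = Nr / 4 := by ring
  set m : ℝ := (⌊x⌋₊ : ℝ) with hm
  have hm16 : (16 : ℝ) ≤ m := by linarith
  have hm0 : (0 : ℝ) < m := by linarith
  -- m^{3/4} ≤ m/2
  have hquarter : (2 : ℝ) ≤ m ^ ((1 : ℝ) / 4) := by
    have h16 : (16 : ℝ) ^ ((1 : ℝ) / 4) = 2 := by
      rw [show (16 : ℝ) = 2 ^ (4 : ℝ) by norm_num, ← Real.rpow_mul (by norm_num)]
      norm_num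
    rw [← h16]
    exact Real.rpow_le_rpow (by norm_num) hm16 (by norm_num)
  have hsplit : m = m ^ ((3 : ℝ) / 4) * m ^ ((1 : ℝ) / 4) := by
    rw [← Real.rpow_add hm0]
    norm_num
  have h34 : 0 ≤ m ^ ((3 : ℝ) / 4) := Real.rpow_nonneg hm0.le _
  have hm34 : m ^ ((3 : ℝ) / 4) ≤ m / 2 := by
    have : m ^ ((3 : ℝ) / 4) * 2 ≤ m ^ ((3 : ℝ) / 4) * m ^ ((1 : ℝ) / 4) :=
      mul_le_mul_of_nonneg_left hquarter h34
    linarith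
  -- unpack the window
  obtain ⟨hjlo, hjhi⟩ := abs_sub_le_iff.1 hj
  have hjlow : m / 2 ≤ j := by linarith
  have hjup : (j : ℝ) ≤ 2 * m := by linarith
  refine ⟨by linarith, ?_, ?_⟩
  · have : (1 : ℝ) ≤ j := by linarith
    exact_mod_cast this
  · have h2j : (2 : ℝ) * j ≤ Nr := by linarith
    rw [hNr] at h2j
    exact_mod_cast h2j

/-- **The window clause of the reduction (proved; the content the Disproof's `not_innerConcNoWindow` /
`not_innerConcWindowAbove` say is load-bearing).** For `k ≥ 3`, `K₁, K₂ ≥ 0`, `ε > 0`: eventually in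
`n`, every central `j` has `1 ≤ j`, `2j ≤ C(n,2)` and SLICE-GAP rate `(K₁ (log(n+2))^{d−1} + K₂)/√j ≤ ε`.
[folklore] -/
theorem window_rate (k d : ℕ) (hk : 3 ≤ k) (K₁ K₂ ε : ℝ) (hK₁ : 0 ≤ K₁) (hK₂ : 0 ≤ K₂) (hε : 0 < ε) :
    ∀ᶠ n : ℕ in atTop, ∀ j : ℕ,
      |(j : ℝ) - (⌊((n.choose 2 : ℕ) : ℝ) * (n : ℝ) ^ (-(2 : ℝ) / ((k : ℝ) - 1))⌋₊ : ℝ)| ≤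
        (⌊((n.choose 2 : ℕ) : ℝ) * (n : ℝ) ^ (-(2 : ℝ) / ((k : ℝ) - 1))⌋₊ : ℝ) ^ ((3 : ℝ) / 4) →
      1 ≤ j ∧ 2 * j ≤ n.choose 2 ∧
        (K₁ * Real.log ((n : ℝ) + 2) ^ (d - 1) + K₂) / Real.sqrt j ≤ ε := by
  filter_upwards [window_bounds k hk, rate_small (d - 1) K₁ K₂ ε hK₁ hK₂ hε] with n hwin hrate
  intro j hj
  obtain ⟨hnj, hj1, hjN⟩ := hwin j hj
  exact ⟨hj1, hjN, hrate j hnj hj1⟩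

/-! ## The composition -/

/-- **Composition (kernel-checked; `sorry` only inside the five stubs S1–S5) — the common reduction.**
`SliceACZero` BY NAME. The crux is `Hyp → Conc` definitionally (read back with `gnpDisagreeProb`,
`cliqueFn`, `edgeCount`). Given `Hyp`, fix `d c`, take `(k, δ)` from `Hyp d c` and answer `Conc d c`
with `(k, δ/2)`; eventually in `n` (the intersection of `Hyp`'s clause and `window_rate` with the constants
`K₁, K₂` of `sliceGap d c k` and `ε = δ/2`): for a central `j` and a circuit `C` over `acBasis` of
`acDepth ≤ d` with slice error `≤ (δ/2) · #slice`, either `n^c < |C|` or `|C| ≤ n^c`, and in the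
latter case SLICE GAP + `window_rate` give `Pr_{G(n,j/N)}[C ≠ CLIQUE_k] ≤ δ/2 + δ/2 = δ`, while `q = j/N`
lies in `[0,1]` and in `Hyp`'s window (`q·N = j`), so `Hyp` yields `n^c < |C|` anyway. `Hyp` is
used exactly once, at the matched density `q = j/N` and the same `(d, c)`. -/
theorem SliceACZero_of : SliceACZero := by
  classical
  intro hHyp d c
  obtain ⟨k, hk, δ, hδ, hev⟩ := hHyp d c
  obtain ⟨K₁, K₂, hK₁, hK₂, hgap⟩ := sliceGap d c k
  refine ⟨k, hk, δ / 2, by positivity, ?_⟩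
  filter_upwards [hev, window_rate k d hk K₁ K₂ (δ / 2) hK₁ hK₂ (by positivity)] with n hn hrate
  intro j hj C hB hD herr
  obtain ⟨hj1, hjN, hsmall⟩ := hrate j hj
  by_contra hsize
  push Not at hsize
  -- the data in the read-back vocabulary
  have herr' : (#(univ.filter fun x : (⊤ : SimpleGraph (Fin n)).edgeSet → Bool =>
        edgeCount x = j ∧ C.eval x ≠ cliqueFn n k x) : ℝ) ≤
      δ / 2 * #(univ.filter fun x : (⊤ : SimpleGraph (Fin n)).edgeSet → Bool => edgeCount x = j) :=
    herr
  have hg := hgap n j C hj1 hjN hB hD hsize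
  have hNpos : 0 < n.choose 2 := by omega
  have hNr : (0 : ℝ) < (n.choose 2 : ℕ) := by exact_mod_cast hNpos
  have hq0 : (0 : ℝ) ≤ (j : ℝ) / (n.choose 2 : ℕ) := by positivity
  have hq1 : (j : ℝ) / (n.choose 2 : ℕ) ≤ 1 := by
    rw [div_le_one hNr]
    exact_mod_cast (by omega : j ≤ n.choose 2)
  have hwin : |(j : ℝ) / (n.choose 2 : ℕ) * (n.choose 2 : ℕ) -
        (⌊((n.choose 2 : ℕ) : ℝ) * (n : ℝ) ^ (-(2 : ℝ) / ((k : ℝ) - 1))⌋₊ : ℝ)| ≤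
      (⌊((n.choose 2 : ℕ) : ℝ) * (n : ℝ) ^ (-(2 : ℝ) / ((k : ℝ) - 1))⌋₊ : ℝ) ^ ((3 : ℝ) / 4) := by
    rw [div_mul_cancel₀ _ hNr.ne']
    exact hj
  have hfrac : (#(univ.filter fun x : (⊤ : SimpleGraph (Fin n)).edgeSet → Bool =>
        edgeCount x = j ∧ C.eval x ≠ cliqueFn n k x) : ℝ) /
      #(univ.filter fun x : (⊤ : SimpleGraph (Fin n)).edgeSet → Bool => edgeCount x = j) ≤ δ / 2 :=
    div_le_of_le_mul₀ (Nat.cast_nonneg _) (by positivity) herr'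
  have hgnp : gnpDisagreeProb n ((j : ℝ) / (n.choose 2 : ℕ)) C.eval (cliqueFn n k) ≤ δ := by
    have h2 := (abs_sub_le_iff.1 hg).2
    linarith
  exact absurd (hn _ hq0 hq1 hwin C hB hD hgnp) (not_lt.2 hsize)

end Summit.PneNP.PneNP.Cruxes.SliceACZero.BinomialHybridInfluenceBudget

end
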